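import Summits.AnomalousDissipation.AnomalousDissipation.Theorems.SawtoothPulseCascadeK1LocalisedCascadeLedgerCascadeV

/-!
# K1loc, line `Spectral` / SeqCone — helper: THE CASCADE LEDGER CLOSES MODULO THE FIRST GOOD PIECE (S-B assembly, top)

Helper file of the prover lane on the crux `K1LocalisedCascade` (stmt-AnomalousDissipation-19491), route
`SawtoothPulseCascade` (S-B/S-C assembly seat).  END OF THE S-B LANE: the geometrically decaying H and V half-slots of the
concrete cascade ledger (`…LedgerCascadeH/V`), the schedule's low block and growth rate (`…LedgerSchedule`: `c = L₀`,
`ρ > γ² − 3`) and the top assembly `…K1Ledger.highModeConcentration_of_geometric_ledger'` give: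
* **`highModeConcentration_of_firstGoodPiece`** — for the cascade at the crux point (`N₀ = 1`, `ρN = 2`, `d = 2`,
  `5 ≤ γ ≤ 8`, `0 < δ₀ ≤ 1/4`; any `L₀ ≥ 1000`, any bounded datum `θ₀ ≠ 0`) there are constants `K_ε, K_ζ ≥ 0` and a rate
  `0 ≤ θ < 1` such that FOR EVERY start phase `i₀` and level `q ≥ 0`: the first-good-piece socket (limit form: for every
  `η > 0` a `κ₁ > 0` below which `‖μᴴ_{i₀}(D) w(tStart i₀)‖ ≤ q + η` for all classical cascade scalars `w` from `θ₀`) and the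
  budget `√(q² + K_ζθ^{i₀}/(1−θ)) + K_εθ^{i₀}/(1−θ) < ‖θ₀‖` imply the body of the registered stub
  `stub_highModeConcentration` for `(P, r = γ² − 3, θ₀)`;
* **`highModeConcentration_of_uniform_firstGoodPiece`** — hence, if the first good piece is UNIFORM in the start phase
  (`q < ‖θ₀‖` fixed and the socket holds for all `i₀ ≥ i₁`), the stub body holds outright (choose `i₀` large).
So the registered stub — and, at `δ₀ = 1/4` replaced by a symbolic `δ₀ ≤ 1/4`, the crux — is reduced to ONE statement about
ONE explicit inviscid iterate per start phase (S-D, `…K1Start.sqrt_tsum_symbol_sq_le_of_inviscid`).  The constants are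
existential (tree's smooth-step bounds) — which is exactly why the uniform form is the one that closes.  No definitions;
no statement about the stub itself is claimed. [cite: DEIJ2022, (1.2)–(1.3)] [cite: ElgindiLissMattingly2025, §1.2 and §3.1] [problem: turb]
-/

-- `Summit.<Summit>.<Problem>`: single-conjunct summit, the duplicate namespace segment is deliberate.
set_option linter.dupNamespace false

noncomputable section

namespace Summit.AnomalousDissipation.AnomalousDissipation.Theorems.SawtoothPulseCascade.K1Ledger

open MeasureTheory Set Filter Topology UnitAddTorus Function
open scoped ENNReal
open Literature.Analysis Literature.Analysis.FunctionSpaces Literature.Analysis.FunctionSpaces.Torus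
open Literature.Analysis.FluidPDE.Torus (highModeEnergy)
open Literature.Analysis.FluidPDE.SawtoothCascade Literature.Analysis.FluidPDE.SawtoothCascade.CascadeParams
open Summit.AnomalousDissipation.AnomalousDissipation.Theorems.SawtoothPulseCascade.K1Symbol

section Cascade

variable (P : CascadeParams)

/-- **The cascade ledger closes modulo the first good piece.**  See the module docstring; `μᴴ_{i₀}` is the start-of-phase
product symbol of the schedule (`L_{i₀} = L₀ρ^{i₀}`, `R_{i₀} = 2L₀Γ^{i₀}`, `w_{i₀} = L_{i₀}/(20γ(1+1/250))`).
[cite: DEIJ2022, (1.2)–(1.3)] [cite: ElgindiLissMattingly2025, §1.2 and §3.1] -/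
theorem highModeConcentration_of_firstGoodPiece (hγ : 5 ≤ P.γ) (hγ' : P.γ ≤ 8) (hδ₀ : 0 < P.δ₀) (hδ₀' : P.δ₀ ≤ 1 / 4)
    (hd : P.d = 2) (hN₀ : P.N₀ = 1) (hρN : P.ρN = 2) {L₀ : ℝ} (hL₀ : 1000 ≤ L₀)
    {θ₀ : UnitAddTorus (Fin 2) → ℝ} (hθ₀ : 0 < FluidPDE.Torus.scalarL2Sq θ₀) {B : ℝ} (hB : ∀ x, |θ₀ x| ≤ B) :
    ∃ Kε Kζ θ : ℝ, 0 ≤ Kε ∧ 0 ≤ Kζ ∧ 0 ≤ θ ∧ θ < 1 ∧ ∀ (i₀ : ℕ) (q : ℝ), 0 ≤ q →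
      (∀ η : ℝ, 0 < η → ∃ κ₁ : ℝ, 0 < κ₁ ∧ ∀ κ ∈ Ioc (0 : ℝ) κ₁, ∀ w : ℝ → UnitAddTorus (Fin 2) → ℝ,
        FluidPDE.Torus.IsClassicalScalarTransportOn (Ico 0 1) κ P.field w → w 0 = θ₀ →
          Real.sqrt (∑' k : Fin 2 → ℤ, (1 - Real.smoothTransition ((|((k 0 : ℤ) : ℝ)| - L₀ * ((P.γ ^ 2 - 5 / 2) / (1 + 1 / 250) ^ 2 - 1 / (2 * (1 + 1 / 250) * L₀)) ^ i₀) /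
            (1 / 250 * (L₀ * ((P.γ ^ 2 - 5 / 2) / (1 + 1 / 250) ^ 2 - 1 / (2 * (1 + 1 / 250) * L₀)) ^ i₀))) *
          (1 - Real.smoothTransition ((P.γ * |((k 1 : ℤ) : ℝ)| - 13 / 10 * |((k 0 : ℤ) : ℝ)|) /
            (1 / 20 * (L₀ * ((P.γ ^ 2 - 5 / 2) / (1 + 1 / 250) ^ 2 - 1 / (2 * (1 + 1 / 250) * L₀)) ^ i₀)))) *
        ((1 - Real.smoothTransition ((|((k 0 : ℤ) : ℝ)| - 2 * L₀ * ((1 + P.γ) ^ 2 + 1) ^ i₀) /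
            (L₀ * ((P.γ ^ 2 - 5 / 2) / (1 + 1 / 250) ^ 2 - 1 / (2 * (1 + 1 / 250) * L₀)) ^ i₀ / (20 * P.γ * (1 + 1 / 250))))) *
          (1 - Real.smoothTransition ((|((k 1 : ℤ) : ℝ)| - 2 * L₀ * ((1 + P.γ) ^ 2 + 1) ^ i₀) /
            (L₀ * ((P.γ ^ 2 - 5 / 2) / (1 + 1 / 250) ^ 2 - 1 / (2 * (1 + 1 / 250) * L₀)) ^ i₀ / (20 * P.γ * (1 + 1 / 250))))))) ^ 2 *
            ‖mFourierCoeff (fun x => (w (tStart i₀) x : ℂ)) k‖ ^ 2) ≤ q + η) →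
      Real.sqrt (q ^ 2 + Kζ * θ ^ i₀ / (1 - θ)) + Kε * θ ^ i₀ / (1 - θ) < Real.sqrt (FluidPDE.Torus.scalarL2Sq θ₀) →
      ∃ χ : ℝ, 0 < χ ∧ ∃ A' : ℕ, ∃ κ₀ : ℝ, 0 < κ₀ ∧ ∀ κ ∈ Ioc (0 : ℝ) κ₀,
      ∀ w : ℝ → UnitAddTorus (Fin 2) → ℝ,
        FluidPDE.Torus.IsClassicalScalarTransportOn (Ico 0 1) κ P.field w → w 0 = θ₀ →
        ∃ K : ℝ, 0 ≤ K ∧ 1 ≤ 8 * Real.pi ^ 2 * κ * K ^ 2 * tHalf (Jrate (P.γ ^ 2 - 3) κ + A') ∧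
          ENNReal.ofReal (2 * χ * FluidPDE.Torus.scalarL2Sq θ₀) ≤
            highModeEnergy 0 K (w (tStart (Jrate (P.γ ^ 2 - 3) κ + A'))) +
              2 * FluidPDE.Torus.eScalarDissipation κ w 0 (tStart (Jrate (P.γ ^ 2 - 3) κ + A')) := by
  have hL0 : 0 < L₀ := by linarith
  have hr1 : 1 < P.γ ^ 2 - 3 := one_lt_rate hγ
  have hrρ : P.γ ^ 2 - 3 < ((P.γ ^ 2 - 5 / 2) / (1 + 1 / 250) ^ 2 - 1 / (2 * (1 + 1 / 250) * L₀)) := rate_lt_rho hγ hγ' hL₀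
  have hr22 : (22 : ℝ) ≤ P.γ ^ 2 - 3 := by nlinarith
  have hρ16 : 16 < ((P.γ ^ 2 - 5 / 2) / (1 + 1 / 250) ^ 2 - 1 / (2 * (1 + 1 / 250) * L₀)) := by linarith
  obtain ⟨hΘθ, hθ1, hθ0⟩ := theta_facts hρ16
  obtain ⟨KεH, KζH, hKεH, hKζH, HH⟩ := exists_geometric_hstepH P hγ hγ' hδ₀ hδ₀' hd hN₀ hρN hL₀ (θ₀ := θ₀) hB
  obtain ⟨KεV, KζV, hKεV, hKζV, HV⟩ := exists_geometric_hstepV P hγ hγ' hδ₀ hδ₀' hd hN₀ hρN hL₀ (θ₀ := θ₀) hB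
  refine ⟨KεH + KεV, KζH + KζV, Real.sqrt (Real.sqrt (max (16 / ((P.γ ^ 2 - 5 / 2) / (1 + 1 / 250) ^ 2 - 1 / (2 * (1 + 1 / 250) * L₀))) (1 / 2))), by positivity, by positivity, hθ0, hθ1, ?_⟩
  intro i₀ q hq hstart hbudget
  exact highModeConcentration_of_geometric_ledger' P hr1 hrρ hL0 hθ₀
    (fun (j : ℕ) (k : Fin 2 → ℤ) => 1 - Real.smoothTransition ((|((k 0 : ℤ) : ℝ)| - L₀ * ((P.γ ^ 2 - 5 / 2) / (1 + 1 / 250) ^ 2 - 1 / (2 * (1 + 1 / 250) * L₀)) ^ j) /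
            (1 / 250 * (L₀ * ((P.γ ^ 2 - 5 / 2) / (1 + 1 / 250) ^ 2 - 1 / (2 * (1 + 1 / 250) * L₀)) ^ j))) *
          (1 - Real.smoothTransition ((P.γ * |((k 1 : ℤ) : ℝ)| - 13 / 10 * |((k 0 : ℤ) : ℝ)|) /
            (1 / 20 * (L₀ * ((P.γ ^ 2 - 5 / 2) / (1 + 1 / 250) ^ 2 - 1 / (2 * (1 + 1 / 250) * L₀)) ^ j)))) *
        ((1 - Real.smoothTransition ((|((k 0 : ℤ) : ℝ)| - 2 * L₀ * ((1 + P.γ) ^ 2 + 1) ^ j) /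
            (L₀ * ((P.γ ^ 2 - 5 / 2) / (1 + 1 / 250) ^ 2 - 1 / (2 * (1 + 1 / 250) * L₀)) ^ j / (20 * P.γ * (1 + 1 / 250))))) *
          (1 - Real.smoothTransition ((|((k 1 : ℤ) : ℝ)| - 2 * L₀ * ((1 + P.γ) ^ 2 + 1) ^ j) /
            (L₀ * ((P.γ ^ 2 - 5 / 2) / (1 + 1 / 250) ^ 2 - 1 / (2 * (1 + 1 / 250) * L₀)) ^ j / (20 * P.γ * (1 + 1 / 250)))))))
    (fun (j : ℕ) (k : Fin 2 → ℤ) => 1 - Real.smoothTransition ((|((k 0 : ℤ) : ℝ)| -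
              L₀ * ((P.γ ^ 2 - 5 / 2) / (1 + 1 / 250) ^ 2 - 1 / (2 * (1 + 1 / 250) * L₀)) ^ j / (1 + 1 / 250)) /
            (1 / 250 * (L₀ * ((P.γ ^ 2 - 5 / 2) / (1 + 1 / 250) ^ 2 - 1 / (2 * (1 + 1 / 250) * L₀)) ^ j / (1 + 1 / 250)))) *
          (1 - Real.smoothTransition ((P.γ * |((k 1 : ℤ) : ℝ) + P.γ * ((k 0 : ℤ) : ℝ)| - 29 / 20 * |((k 0 : ℤ) : ℝ)|) /
              (1 / 20 * (L₀ * ((P.γ ^ 2 - 5 / 2) / (1 + 1 / 250) ^ 2 - 1 / (2 * (1 + 1 / 250) * L₀)) ^ j / (1 + 1 / 250)))) *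
            Real.smoothTransition ((P.γ * |((k 1 : ℤ) : ℝ) - P.γ * ((k 0 : ℤ) : ℝ)| - 29 / 20 * |((k 0 : ℤ) : ℝ)|) /
              (1 / 20 * (L₀ * ((P.γ ^ 2 - 5 / 2) / (1 + 1 / 250) ^ 2 - 1 / (2 * (1 + 1 / 250) * L₀)) ^ j / (1 + 1 / 250))))) *
        ((1 - Real.smoothTransition ((|((k 0 : ℤ) : ℝ)| -
              ((1 + P.γ) * (2 * L₀ * ((1 + P.γ) ^ 2 + 1) ^ j +
                L₀ * ((P.γ ^ 2 - 5 / 2) / (1 + 1 / 250) ^ 2 - 1 / (2 * (1 + 1 / 250) * L₀)) ^ j / (20 * P.γ * (1 + 1 / 250))) +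
                1 / 2)) /
            (L₀ * ((P.γ ^ 2 - 5 / 2) / (1 + 1 / 250) ^ 2 - 1 / (2 * (1 + 1 / 250) * L₀)) ^ j / (20 * P.γ * (1 + 1 / 250))))) *
          (1 - Real.smoothTransition ((|((k 1 : ℤ) : ℝ)| -
              ((1 + P.γ) * (2 * L₀ * ((1 + P.γ) ^ 2 + 1) ^ j +
                L₀ * ((P.γ ^ 2 - 5 / 2) / (1 + 1 / 250) ^ 2 - 1 / (2 * (1 + 1 / 250) * L₀)) ^ j / (20 * P.γ * (1 + 1 / 250))) +
                1 / 2)) /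
            (L₀ * ((P.γ ^ 2 - 5 / 2) / (1 + 1 / 250) ^ 2 - 1 / (2 * (1 + 1 / 250) * L₀)) ^ j / (20 * P.γ * (1 + 1 / 250)))))))
    (fun j k => abs_muH_le_one P.γ L₀ j k) (i₀ := i₀)
    (fun J _ k hk => one_le_muH_sq_of_lt hγ hγ' hL₀ J k hk) hKεH hKζH hKεV hKζV hθ0 hθ1 one_pos
    (fun κ hκ w hw h0 j _ hj => HH κ hκ w hw h0 j (Nat.zero_le j) hj)
    (fun κ hκ w hw h0 j _ hj => HV κ hκ w hw h0 j (Nat.zero_le j) hj) hq hstart hbudget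

/-- **The cascade ledger closes under a UNIFORM first good piece.**  If the first-good-piece socket holds with a FIXED level
`q < ‖θ₀‖` for every start phase `i₀ ≥ i₁`, the stub body holds: the ledger's errors `K θ^{i₀}/(1−θ)` vanish as `i₀ → ∞`,
so some admissible `i₀` meets the budget. [cite: DEIJ2022, (1.2)–(1.3)] [cite: ElgindiLissMattingly2025, §1.2 and §3.1] -/
theorem highModeConcentration_of_uniform_firstGoodPiece (hγ : 5 ≤ P.γ) (hγ' : P.γ ≤ 8) (hδ₀ : 0 < P.δ₀)
    (hδ₀' : P.δ₀ ≤ 1 / 4) (hd : P.d = 2) (hN₀ : P.N₀ = 1) (hρN : P.ρN = 2) {L₀ : ℝ} (hL₀ : 1000 ≤ L₀)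
    {θ₀ : UnitAddTorus (Fin 2) → ℝ} (hθ₀ : 0 < FluidPDE.Torus.scalarL2Sq θ₀) {B : ℝ} (hB : ∀ x, |θ₀ x| ≤ B)
    {q : ℝ} (hq : 0 ≤ q) (hqE : q < Real.sqrt (FluidPDE.Torus.scalarL2Sq θ₀)) {i₁ : ℕ}
    (hstart : ∀ i₀ : ℕ, i₁ ≤ i₀ →
      ∀ η : ℝ, 0 < η → ∃ κ₁ : ℝ, 0 < κ₁ ∧ ∀ κ ∈ Ioc (0 : ℝ) κ₁, ∀ w : ℝ → UnitAddTorus (Fin 2) → ℝ,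
        FluidPDE.Torus.IsClassicalScalarTransportOn (Ico 0 1) κ P.field w → w 0 = θ₀ →
          Real.sqrt (∑' k : Fin 2 → ℤ, (1 - Real.smoothTransition ((|((k 0 : ℤ) : ℝ)| - L₀ * ((P.γ ^ 2 - 5 / 2) / (1 + 1 / 250) ^ 2 - 1 / (2 * (1 + 1 / 250) * L₀)) ^ i₀) /
            (1 / 250 * (L₀ * ((P.γ ^ 2 - 5 / 2) / (1 + 1 / 250) ^ 2 - 1 / (2 * (1 + 1 / 250) * L₀)) ^ i₀))) *
          (1 - Real.smoothTransition ((P.γ * |((k 1 : ℤ) : ℝ)| - 13 / 10 * |((k 0 : ℤ) : ℝ)|) /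
            (1 / 20 * (L₀ * ((P.γ ^ 2 - 5 / 2) / (1 + 1 / 250) ^ 2 - 1 / (2 * (1 + 1 / 250) * L₀)) ^ i₀)))) *
        ((1 - Real.smoothTransition ((|((k 0 : ℤ) : ℝ)| - 2 * L₀ * ((1 + P.γ) ^ 2 + 1) ^ i₀) /
            (L₀ * ((P.γ ^ 2 - 5 / 2) / (1 + 1 / 250) ^ 2 - 1 / (2 * (1 + 1 / 250) * L₀)) ^ i₀ / (20 * P.γ * (1 + 1 / 250))))) *
          (1 - Real.smoothTransition ((|((k 1 : ℤ) : ℝ)| - 2 * L₀ * ((1 + P.γ) ^ 2 + 1) ^ i₀) /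
            (L₀ * ((P.γ ^ 2 - 5 / 2) / (1 + 1 / 250) ^ 2 - 1 / (2 * (1 + 1 / 250) * L₀)) ^ i₀ / (20 * P.γ * (1 + 1 / 250))))))) ^ 2 *
            ‖mFourierCoeff (fun x => (w (tStart i₀) x : ℂ)) k‖ ^ 2) ≤ q + η) :
    ∃ χ : ℝ, 0 < χ ∧ ∃ A' : ℕ, ∃ κ₀ : ℝ, 0 < κ₀ ∧ ∀ κ ∈ Ioc (0 : ℝ) κ₀,
      ∀ w : ℝ → UnitAddTorus (Fin 2) → ℝ,
        FluidPDE.Torus.IsClassicalScalarTransportOn (Ico 0 1) κ P.field w → w 0 = θ₀ →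
        ∃ K : ℝ, 0 ≤ K ∧ 1 ≤ 8 * Real.pi ^ 2 * κ * K ^ 2 * tHalf (Jrate (P.γ ^ 2 - 3) κ + A') ∧
          ENNReal.ofReal (2 * χ * FluidPDE.Torus.scalarL2Sq θ₀) ≤
            highModeEnergy 0 K (w (tStart (Jrate (P.γ ^ 2 - 3) κ + A'))) +
              2 * FluidPDE.Torus.eScalarDissipation κ w 0 (tStart (Jrate (P.γ ^ 2 - 3) κ + A')) := by
  obtain ⟨Kε, Kζ, θ, hKε, hKζ, hθ0, hθ1, hmain⟩ :=
    highModeConcentration_of_firstGoodPiece P hγ hγ' hδ₀ hδ₀' hd hN₀ hρN hL₀ hθ₀ hB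
  -- the margin and a start phase beyond which the ledger's errors fit into it
  set m : ℝ := (Real.sqrt (FluidPDE.Torus.scalarL2Sq θ₀) - q) / 2 with hm
  have hm0 : 0 < m := by rw [hm]; linarith
  have h1θ : 0 < 1 - θ := by linarith
  set τ : ℝ := min (m ^ 2 * (1 - θ) / (Kζ + 1)) (m * (1 - θ) / (Kε + 1)) with hτ
  have hτ0 : 0 < τ := lt_min (by positivity) (by positivity)
  obtain ⟨n₀, hn₀⟩ := exists_pow_lt_of_lt_one hτ0 hθ1
  set i₀ : ℕ := max n₀ i₁ with hi₀
  have hθi : θ ^ i₀ ≤ θ ^ n₀ := pow_le_pow_of_le_one hθ0 hθ1.le (le_max_left _ _)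
  have hθτ : θ ^ i₀ < τ := lt_of_le_of_lt hθi hn₀
  have hZ : Kζ * θ ^ i₀ / (1 - θ) ≤ Kζ * m ^ 2 / (Kζ + 1) := by
    have h1 : θ ^ i₀ ≤ m ^ 2 * (1 - θ) / (Kζ + 1) := hθτ.le.trans (min_le_left _ _)
    rw [div_le_iff₀ h1θ]
    calc Kζ * θ ^ i₀ ≤ Kζ * (m ^ 2 * (1 - θ) / (Kζ + 1)) := mul_le_mul_of_nonneg_left h1 hKζ
      _ = Kζ * m ^ 2 / (Kζ + 1) * (1 - θ) := by field_simp
  have hE : Kε * θ ^ i₀ / (1 - θ) ≤ Kε * m / (Kε + 1) := by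
    have h1 : θ ^ i₀ ≤ m * (1 - θ) / (Kε + 1) := hθτ.le.trans (min_le_right _ _)
    rw [div_le_iff₀ h1θ]
    calc Kε * θ ^ i₀ ≤ Kε * (m * (1 - θ) / (Kε + 1)) := mul_le_mul_of_nonneg_left h1 hKε
      _ = Kε * m / (Kε + 1) * (1 - θ) := by field_simp
  have hZm : Kζ * m ^ 2 / (Kζ + 1) < m ^ 2 := by
    rw [div_lt_iff₀ (by positivity)]; nlinarith
  have hEm : Kε * m / (Kε + 1) < m := by
    rw [div_lt_iff₀ (by positivity)]; nlinarith
  have hZ0 : 0 ≤ Kζ * θ ^ i₀ / (1 - θ) := by positivity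
  have hsq : Real.sqrt (q ^ 2 + Kζ * θ ^ i₀ / (1 - θ)) ≤ q + Real.sqrt (Kζ * θ ^ i₀ / (1 - θ)) := by
    have h := sqrt_sq_add_le hq (Real.sqrt_nonneg (Kζ * θ ^ i₀ / (1 - θ))) (le_refl (0:ℝ))
    simp only [add_zero] at h
    calc Real.sqrt (q ^ 2 + Kζ * θ ^ i₀ / (1 - θ))
        = Real.sqrt ((q + Real.sqrt (Kζ * θ ^ i₀ / (1 - θ))) ^ 2 - 2 * q * Real.sqrt (Kζ * θ ^ i₀ / (1 - θ))) := by
          rw [add_sq, Real.sq_sqrt hZ0]; ring_nf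
      _ ≤ Real.sqrt ((q + Real.sqrt (Kζ * θ ^ i₀ / (1 - θ))) ^ 2) :=
          Real.sqrt_le_sqrt (by nlinarith [Real.sqrt_nonneg (Kζ * θ ^ i₀ / (1 - θ))])
      _ = q + Real.sqrt (Kζ * θ ^ i₀ / (1 - θ)) := Real.sqrt_sq (by positivity)
  have hsZ : Real.sqrt (Kζ * θ ^ i₀ / (1 - θ)) < m := by
    calc Real.sqrt (Kζ * θ ^ i₀ / (1 - θ)) ≤ Real.sqrt (Kζ * m ^ 2 / (Kζ + 1)) := Real.sqrt_le_sqrt hZ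
      _ < Real.sqrt (m ^ 2) := Real.sqrt_lt_sqrt (by positivity) hZm
      _ = m := Real.sqrt_sq hm0.le
  have hbudget : Real.sqrt (q ^ 2 + Kζ * θ ^ i₀ / (1 - θ)) + Kε * θ ^ i₀ / (1 - θ) <
      Real.sqrt (FluidPDE.Torus.scalarL2Sq θ₀) := by
    have : q + m + m = Real.sqrt (FluidPDE.Torus.scalarL2Sq θ₀) := by rw [hm]; ring
    linarith [hE.trans_lt hEm]
  exact hmain i₀ q hq (hstart i₀ (le_max_right _ _)) hbudget

end Cascade

end Summit.AnomalousDissipation.AnomalousDissipation.Theorems.SawtoothPulseCascade.K1Ledger
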